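import Mathlib
import Summits.ValiantsHypothesis.ValiantsHypothesis.Theorems.DivisionGapZeroOneTransferFaceIsolationDefs
import Summits.ValiantsHypothesis.ValiantsHypothesis.Theorems.ZeroOneTransfer.Negative.TopComponentFree
import Summits.ValiantsHypothesis.ValiantsHypothesis.Theorems.DivisionGapPerMultiplesHardStubTorus

/-!
# Crux `DivisionGap.ZeroOneTransfer` (stmt-ValiantsHypothesis-5066), line `charged-uncharged`, Part E (lead c13) —
stub `stub_torusD` (E8, TORUS WLOG FOR `D_n`)

Rung E-II of Part E replaces a nonzero cofactor `X` of `D_n = triPM n` (variables `Var n = Vtx n × Vtx n`)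
by a MARGIN-HOMOGENEOUS sub-sum `X₁` at no cost: all exponents of `X₁` have the same first-vertex
margins `∑_w d (v, w)` and the same second-vertex margins `∑_v d (v, w)`, `supp X₁ ⊆ supp X`, and
`L⁺(D_n · X₁) ≤ L⁺(D_n · X)`.

Proof.  `X₁ := ws.foldr topComponent X`, the iterated free top form (`TopComponentFree`:
`complexity_topComponent_le`, `topComponent_mul`) along a list `ws` of the `2n²` indicator weights
`[e.1 = v]` and `[e.2 = w]`.  `D_n` is weighted-homogeneous of degree `1` for each of them: a cover `f`
contributes the exponent `dimerExp f = Σ_u e_(u, f u)`, which has exactly one variable with first vertex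
`v` (namely `(v, f v)`) and, `f` being an involution, exactly one with second vertex `w` (namely
`(f w, w)`).  Hence `top_w (D_n · Y) = D_n · top_w Y` along the list
(`complexity_mul_foldr_topComponent_le`, `foldr_topComponent_ne_zero`,
`isWeightedHomogeneous_foldr_topComponent` of `DivisionGapPerMultiplesHardStubTorus`, generic in the
variable type), the support only shrinks (`support_topComponent_subset`), and the common weights of the
exponents of `X₁` for the indicator weights are the common margins (`TorusD.weight_fstIndicator`,
`TorusD.weight_sndIndicator`, adapted from `weight_rowIndicator`/`weight_colIndicator` there).
[folklore]
-/

noncomputable section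

set_option linter.dupNamespace false

namespace Summit.ValiantsHypothesis.ValiantsHypothesis.Theorems.DivisionGapZeroOneTransfer

open MvPolynomial
open Literature.Computability.AlgebraicComplexity
open Summit.ValiantsHypothesis.ValiantsHypothesis.Theorems.TriangularDimersDivisionEasy.Negative
open Summit.ValiantsHypothesis.ValiantsHypothesis.Theorems.ZeroOneTransfer
open FaceIsolation
open scoped NNReal BigOperators

namespace TorusD

open Summit.ValiantsHypothesis.ValiantsHypothesis.Theorems.ZeroOneTransfer.Negative

variable {n : ℕ}

/-- Iterated top components are sub-sums: the support only shrinks. [folklore] -/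
theorem support_foldr_topComponent_subset {σ : Type*} (ws : List (σ → ℕ))
    (h : MvPolynomial σ ℝ≥0) : (ws.foldr topComponent h).support ⊆ h.support := by
  induction ws with
  | nil => exact subset_rfl
  | cons w ws ih =>
    rw [List.foldr_cons]
    exact (support_topComponent_subset w _).trans ih

-- adapted from DivisionGapPerMultiplesHardStubTorus (`weight_rowIndicator`)
/-- First-vertex indicator weights compute first-vertex margins. [folklore] -/
theorem weight_fstIndicator (v : Vtx n) (d : Var n →₀ ℕ) :
    Finsupp.weight (fun e : Var n => if e.1 = v then 1 else 0) d = ∑ w, d (v, w) := by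
  rw [Finsupp.weight_apply, Finsupp.sum_fintype _ _ (fun _ => by simp), Fintype.sum_prod_type,
    Finset.sum_eq_single_of_mem v (Finset.mem_univ v)]
  · simp
  · intro a _ ha
    simp [ha]

-- adapted from DivisionGapPerMultiplesHardStubTorus (`weight_colIndicator`)
/-- Second-vertex indicator weights compute second-vertex margins. [folklore] -/
theorem weight_sndIndicator (w : Vtx n) (d : Var n →₀ ℕ) :
    Finsupp.weight (fun e : Var n => if e.2 = w then 1 else 0) d = ∑ v, d (v, w) := by
  rw [Finsupp.weight_apply, Finsupp.sum_fintype _ _ (fun _ => by simp),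
    Fintype.sum_prod_type_right, Finset.sum_eq_single_of_mem w (Finset.mem_univ w)]
  · simp
  · intro b _ hb
    simp [hb]

/-- The exponent of a cover has exactly one variable with first vertex `v`, namely `(v, f v)`.
[folklore] -/
theorem weight_fstIndicator_dimerExp (v : Vtx n) (f : Vtx n → Vtx n) :
    Finsupp.weight (fun e : Var n => if e.1 = v then 1 else 0) (dimerExp f) = 1 := by
  rw [weight_fstIndicator]
  simp only [dimerExp_apply]
  rw [Finset.sum_ite_eq]
  simp

/-- The exponent of a cover `f` (an involution) has exactly one variable with second vertex `w`,
namely `(f w, w)`. [folklore] -/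
theorem weight_sndIndicator_dimerExp (w : Vtx n) {f : Vtx n → Vtx n} (hf : f ∈ dimers n) :
    Finsupp.weight (fun e : Var n => if e.2 = w then 1 else 0) (dimerExp f) = 1 := by
  rw [dimers, Finset.mem_filter] at hf
  rw [weight_sndIndicator]
  simp only [dimerExp_apply]
  have hinv : ∀ v, (f v = w) ↔ (v = f w) := fun v =>
    ⟨fun h => by rw [← h, (hf.2 v).1], fun h => by rw [h, (hf.2 w).1]⟩
  simp_rw [hinv]
  rw [Finset.sum_ite_eq']
  simp

/-- `D_n` takes exactly one variable with each first vertex: it is homogeneous of degree `1` for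
every first-vertex indicator weight. [folklore] -/
theorem isWeightedHomogeneous_triPM_fst (v : Vtx n) :
    IsWeightedHomogeneous (fun e : Var n => if e.1 = v then 1 else 0) (triPM n) 1 := by
  intro d hd
  obtain ⟨f, -, rfl⟩ := (mem_support_triPM d).1 (mem_support_iff.2 hd)
  exact weight_fstIndicator_dimerExp v f

/-- `D_n` takes exactly one variable with each second vertex: it is homogeneous of degree `1` for
every second-vertex indicator weight. [folklore] -/
theorem isWeightedHomogeneous_triPM_snd (w : Vtx n) :
    IsWeightedHomogeneous (fun e : Var n => if e.2 = w then 1 else 0) (triPM n) 1 := by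
  intro d hd
  obtain ⟨f, hf, rfl⟩ := (mem_support_triPM d).1 (mem_support_iff.2 hd)
  exact weight_sndIndicator_dimerExp w hf

end TorusD

/-- **Stub E8 — TORUS WLOG FOR `D_n`** (free iterated top forms along the `2n²` first- and second-vertex
indicator weights, for each of which `D_n` is homogeneous of degree `1`): a nonzero cofactor may be
replaced, at no cost and inside its own support, by a MARGIN-HOMOGENEOUS one. [folklore] -/
theorem stub_torusD : ∀ (n : ℕ) (X : MvPolynomial (Var n) ℝ≥0), X ≠ 0 →
    ∃ X₁ : MvPolynomial (Var n) ℝ≥0, X₁ ≠ 0 ∧ X₁.support ⊆ X.support ∧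
      (∀ d₁ ∈ X₁.support, ∀ d₂ ∈ X₁.support,
        (∀ v : Vtx n, ∑ w, d₁ (v, w) = ∑ w, d₂ (v, w)) ∧ (∀ w : Vtx n, ∑ v, d₁ (v, w) = ∑ v, d₂ (v, w))) ∧
      complexity (triPM n * X₁) ≤ complexity (triPM n * X) := by
  intro n X hX
  let ws : List (Var n → ℕ) :=
    ((Finset.univ : Finset (Vtx n)).toList.map fun v e => if e.1 = v then 1 else 0) ++
      ((Finset.univ : Finset (Vtx n)).toList.map fun w e => if e.2 = w then 1 else 0)
  have hfst_mem : ∀ v : Vtx n, (fun e : Var n => if e.1 = v then 1 else 0) ∈ ws := fun v =>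
    List.mem_append_left _ (List.mem_map.2 ⟨v, Finset.mem_toList.2 (Finset.mem_univ v), rfl⟩)
  have hsnd_mem : ∀ w : Vtx n, (fun e : Var n => if e.2 = w then 1 else 0) ∈ ws := fun w =>
    List.mem_append_right _ (List.mem_map.2 ⟨w, Finset.mem_toList.2 (Finset.mem_univ w), rfl⟩)
  refine ⟨ws.foldr Negative.topComponent X,
    DivisionGap.PerMultiplesHard.Torus.foldr_topComponent_ne_zero ws hX,
    TorusD.support_foldr_topComponent_subset ws X, fun d₁ hd₁ d₂ hd₂ => ⟨fun v => ?_, fun w => ?_⟩, ?_⟩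
  · obtain ⟨m, hm⟩ :=
      DivisionGap.PerMultiplesHard.Torus.isWeightedHomogeneous_foldr_topComponent ws X (hfst_mem v)
    rw [← TorusD.weight_fstIndicator v d₁, ← TorusD.weight_fstIndicator v d₂,
      hm (mem_support_iff.1 hd₁), hm (mem_support_iff.1 hd₂)]
  · obtain ⟨m, hm⟩ :=
      DivisionGap.PerMultiplesHard.Torus.isWeightedHomogeneous_foldr_topComponent ws X (hsnd_mem w)
    rw [← TorusD.weight_sndIndicator w d₁, ← TorusD.weight_sndIndicator w d₂,
      hm (mem_support_iff.1 hd₁), hm (mem_support_iff.1 hd₂)]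
  · refine DivisionGap.PerMultiplesHard.Torus.complexity_mul_foldr_topComponent_le ws _ X
      fun w hw => ?_
    rcases List.mem_append.1 hw with hw' | hw'
    · obtain ⟨v, -, rfl⟩ := List.mem_map.1 hw'
      exact ⟨1, TorusD.isWeightedHomogeneous_triPM_fst v⟩
    · obtain ⟨w, -, rfl⟩ := List.mem_map.1 hw'
      exact ⟨1, TorusD.isWeightedHomogeneous_triPM_snd w⟩

end Summit.ValiantsHypothesis.ValiantsHypothesis.Theorems.DivisionGapZeroOneTransfer

end
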